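import Literature.Computability.AlgebraicComplexity.AlperBogartVelascoBoxFour
import HarnessLib

/-!
# Route `SymPencil` — `7`-dimensional linear subspaces of `Sing Z(per_4)`, V: small rows force a
# detecting pair of columns
# (`--supports` stmt-ValiantsHypothesis-5674 `SdcSuperquadratic`; towards the sizes `m = 21, 22`)

**Theorem** (`false_of_small_rows`).  Let `W` be a `7`-dimensional space of `4 × 4` matrices
(characteristic `0`) on which all `3 × 3` minor-permanents vanish, all of whose ROWS span spaces
`Y_l = row_l(W)` of dimension `≤ 2`.  Then some pair of COLUMNS detects `W` (an `x ∈ W` with those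
two columns zero vanishes).  Stated as: "rows `≤ 2`-dimensional and no detecting column pair" is
contradictory.

Proof.  For a pair of rows `{p, q}` with complement `{r, s}` let `K_{pq} = {x ∈ W : rows p, q zero}`;
`dim K_{pq} ≥ 7 - 2 - 2 = 3`, and `K_{pq}` has non-zero elements `x_u, x_v` supported in row `r`,
resp. `s` alone.  The cubic on rows `(r, s, p)` of `y ± x` (`x ∈ K_{pq}`, `y ∈ W`) gives
`T_c(row_r x, row_s x, w) = 0` for all `w ∈ Y_p + Y_q`.  If `dim (Y_p + Y_q) ≥ 3`, the key step of
ABV BoxFour makes every pairing of `(row_r x, row_s x)` vanish; polarising with `x_u, x_v`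
(`finrank_le_one_of_pairings`) gives `dim row_s(K_{pq}) ≤ 1`, `dim row_r(K_{pq}) ≤ 1`, so
`dim K_{pq} ≤ 2` — contradiction.  Hence `dim (Y_p + Y_q) ≤ 2` for all pairs; three rows have
`dim Y = 2` (`Σ dim Y_l ≥ 7`), so all `Y_l` lie in one plane `P ⊆ K⁴`; two coordinates `k ≠ k'`
separate `P`, and then the columns `k, k'` detect `W`. [folklore]
-/

noncomputable section

-- single-conjunct layout: Sub = Summit, duplicated namespace component intended
set_option linter.dupNamespace false

namespace Summit.ValiantsHypothesis.ValiantsHypothesis.Theorems.SymPencilBoxFourSevenSmall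

open Module Finset
open Literature.Computability.AlgebraicComplexity
open Literature.Computability.AlgebraicComplexity.AlperBogartVelasco

variable {K : Type*} [Field K]

/-- **Rows of dimension `≤ 2` force a detecting pair of columns** (dimension `7`).  See the module
docstring. [folklore] -/
theorem false_of_small_rows [CharZero K] (W : Submodule K (Fin 4 × Fin 4 → K))
    (hW : ∀ x ∈ W, ∀ (r c : Fin 3 → Fin 4), Function.Injective r → Function.Injective c →
      ((Matrix.of fun i j => x (i, j)).submatrix r c).permanent = 0)
    (h7 : finrank K W = 7)
    (hr : ∀ l : Fin 4, finrank K ↥(W.map (LinearMap.funLeft K K fun j : Fin 4 => (l, j))) ≤ 2)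
    (hnc : ¬ ∃ p q : Fin 4, p ≠ q ∧ ∀ x ∈ W, (∀ i, x (i, p) = 0) → (∀ i, x (i, q) = 0) → x = 0) :
    False := by
  classical
  have hcases : ∀ i : Fin 4, i = 0 ∨ i = 1 ∨ i = 2 ∨ i = 3 := by decide
  have e00 : (0 : Fin 4).succAbove 0 = 1 := by decide
  have e01 : (0 : Fin 4).succAbove 1 = 2 := by decide
  have e02 : (0 : Fin 4).succAbove 2 = 3 := by decide
  have e10 : (1 : Fin 4).succAbove 0 = 0 := by decide
  have e11 : (1 : Fin 4).succAbove 1 = 2 := by decide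
  have e12 : (1 : Fin 4).succAbove 2 = 3 := by decide
  have e20 : (2 : Fin 4).succAbove 0 = 0 := by decide
  have e21 : (2 : Fin 4).succAbove 1 = 1 := by decide
  have e22 : (2 : Fin 4).succAbove 2 = 3 := by decide
  have e30 : (3 : Fin 4).succAbove 0 = 0 := by decide
  have e31 : (3 : Fin 4).succAbove 1 = 1 := by decide
  have e32 : (3 : Fin 4).succAbove 2 = 2 := by decide
  let T : Fin 4 → (Fin 4 → K) → (Fin 4 → K) → (Fin 4 → K) → K := fun c u v w =>
    u (c.succAbove 0) * (v (c.succAbove 1) * w (c.succAbove 2) + v (c.succAbove 2) * w (c.succAbove 1)) +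
    u (c.succAbove 1) * (v (c.succAbove 0) * w (c.succAbove 2) + v (c.succAbove 2) * w (c.succAbove 0)) +
    u (c.succAbove 2) * (v (c.succAbove 0) * w (c.succAbove 1) + v (c.succAbove 1) * w (c.succAbove 0))
  have hI5 : ∀ c u v w, T c v w u = 0 → T c u v w = 0 := fun c u v w h => by
    simp only [T] at h ⊢; linear_combination h
  let ρ : Fin 4 → (Fin 4 × Fin 4 → K) →ₗ[K] (Fin 4 → K) :=
    fun r => LinearMap.funLeft K K fun j => (r, j)
  have hρ : ∀ r x j, ρ r x j = x (r, j) := fun _ _ _ => rfl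
  have hF : ∀ y ∈ W, ∀ r₀ r₁ r₂ : Fin 4, r₀ ≠ r₁ → r₀ ≠ r₂ → r₁ ≠ r₂ → ∀ c : Fin 4,
      T c (ρ r₀ y) (ρ r₁ y) (ρ r₂ y) = 0 := by
    intro y hy r₀ r₁ r₂ h01 h02 h12 c
    have hinj : Function.Injective ![r₀, r₁, r₂] := by
      intro a b hab
      fin_cases a <;> fin_cases b <;> simp_all
    have h := hW y hy ![r₀, r₁, r₂] c.succAbove hinj Fin.succAbove_right_injective
    rw [Matrix.permanent_fin_three_row] at h
    simp only [Matrix.submatrix_apply, Matrix.of_apply, Matrix.cons_val_zero, Matrix.cons_val_one,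
      Matrix.cons_val] at h
    simp only [T, hρ]
    linear_combination h
  -- KEY STEP of ABV BoxFour, as an extraction of pairings: a `≥ 3`-dimensional space of third
  -- arguments kills all pairings of the first two
  have pair_of_third : ∀ (Z : Submodule K (Fin 4 → K)) (u v : Fin 4 → K), 3 ≤ finrank K Z →
      (∀ w ∈ Z, ∀ c, T c u v w = 0) → ∀ c₀ j : Fin 4, j ≠ c₀ → u c₀ * v j + u j * v c₀ = 0 := by
    intro Z u v hZ h c₀ j hj
    let f : Z →ₗ[K] K × K := ((LinearMap.proj c₀).prod (LinearMap.proj j)).comp Z.subtype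
    have hker : LinearMap.ker f ≠ ⊥ := LinearMap.ker_ne_bot_of_finrank_lt (by
      rw [finrank_prod, Module.finrank_self]; omega)
    obtain ⟨yY, hyker, hy0⟩ := Submodule.exists_mem_ne_zero_of_ne_bot hker
    have hfy : f yY = 0 := LinearMap.mem_ker.1 hyker
    have hyY : (yY : Fin 4 → K) ∈ Z := yY.2
    have hyc₀ : (yY : Fin 4 → K) c₀ = 0 := congr_arg Prod.fst hfy
    have hyj : (yY : Fin 4 → K) j = 0 := congr_arg Prod.snd hfy
    have hyne : (yY : Fin 4 → K) ≠ 0 := fun h0 => hy0 (Subtype.ext h0)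
    set y : Fin 4 → K := (yY : Fin 4 → K) with hydef
    have h' : ∀ c, T c y u v = 0 := fun c => hI5 c y u v (h y hyY c)
    have hprod : ∀ i, y i * (u c₀ * v j + u j * v c₀) = 0 := by
      have hpairs : ∀ a b : Fin 4, b ≠ a →
          (a = 0 ∧ b = 1) ∨ (a = 0 ∧ b = 2) ∨ (a = 0 ∧ b = 3) ∨ (a = 1 ∧ b = 0) ∨
          (a = 1 ∧ b = 2) ∨ (a = 1 ∧ b = 3) ∨ (a = 2 ∧ b = 0) ∨ (a = 2 ∧ b = 1) ∨
          (a = 2 ∧ b = 3) ∨ (a = 3 ∧ b = 0) ∨ (a = 3 ∧ b = 1) ∨ (a = 3 ∧ b = 2) := by decide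
      have t0 := h' 0
      have t1 := h' 1
      have t2 := h' 2
      have t3 := h' 3
      simp only [T, e00, e01, e02, e10, e11, e12, e20, e21, e22, e30, e31, e32] at t0 t1 t2 t3
      rcases hpairs c₀ j hj with ⟨rfl, rfl⟩ | ⟨rfl, rfl⟩ | ⟨rfl, rfl⟩ | ⟨rfl, rfl⟩ | ⟨rfl, rfl⟩ |
        ⟨rfl, rfl⟩ | ⟨rfl, rfl⟩ | ⟨rfl, rfl⟩ | ⟨rfl, rfl⟩ | ⟨rfl, rfl⟩ | ⟨rfl, rfl⟩ | ⟨rfl, rfl⟩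
      all_goals
        simp only [hyc₀, hyj, zero_mul, zero_add, add_zero] at t0 t1 t2 t3
        intro i
        rcases hcases i with rfl | rfl | rfl | rfl <;>
          first
          | (rw [hyc₀]; ring) | (rw [hyj]; ring)
          | linear_combination t0 | linear_combination t1
          | linear_combination t2 | linear_combination t3
    obtain ⟨i, hi⟩ : ∃ i, y i ≠ 0 := Function.ne_iff.1 hyne
    exact (mul_eq_zero.1 (hprod i)).resolve_left hi
  -- the four rows `p, q, r, s`
  have hall : ∀ p q r s : Fin 4, p ≠ q → p ≠ r → p ≠ s → q ≠ r → q ≠ s → r ≠ s →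
      ∀ i : Fin 4, i = p ∨ i = q ∨ i = r ∨ i = s := by decide
  -- (iii): for every pair of rows, `dim (Y_p + Y_q) ≤ 2`
  have hsup2 : ∀ p q r s : Fin 4, p ≠ q → p ≠ r → p ≠ s → q ≠ r → q ≠ s → r ≠ s →
      finrank K ↥(W.map (ρ p) ⊔ W.map (ρ q)) ≤ 2 := by
    intro p q r s hpq hpr hps hqr hqs hrs
    by_contra hZ
    push Not at hZ
    set Z := W.map (ρ p) ⊔ W.map (ρ q) with hZdef
    set Kpq : Submodule K (Fin 4 × Fin 4 → K) := W ⊓ LinearMap.ker (ρ p) ⊓ LinearMap.ker (ρ q)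
      with hKdef
    have memK : ∀ x ∈ Kpq, x ∈ W ∧ (∀ j, x (p, j) = 0) ∧ ∀ j, x (q, j) = 0 := fun x hx => by
      simp only [hKdef, Submodule.mem_inf, LinearMap.mem_ker] at hx
      exact ⟨hx.1.1, fun j => congr_fun hx.1.2 j, fun j => congr_fun hx.2 j⟩
    -- `dim Kpq ≥ 3`
    have hK3 : 3 ≤ finrank K Kpq := by
      have h1 := finrank_eq_finrank_map_add_finrank_inf_ker W (ρ p)
      have h2 := finrank_eq_finrank_map_add_finrank_inf_ker (W ⊓ LinearMap.ker (ρ p)) (ρ q)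
      have h3 : finrank K ↥((W ⊓ LinearMap.ker (ρ p)).map (ρ q)) ≤ 2 :=
        (Submodule.finrank_mono (Submodule.map_mono inf_le_left)).trans (hr q)
      have h4 := hr p
      change finrank K ↥(W.map (ρ p)) ≤ 2 at h4
      rw [← hKdef] at h2
      omega
    -- `T_c(row_r x, row_s x, w) = 0` for `x ∈ Kpq`, `w ∈ Z`
    have hT1 : ∀ x ∈ Kpq, ∀ (p' : Fin 4), p' ≠ r → p' ≠ s → (∀ j, x (p', j) = 0) →
        ∀ y ∈ W, ∀ c, T c (ρ r x) (ρ s x) (ρ p' y) = 0 := by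
      intro x hx p' hp'r hp's hxp' y hy c
      obtain ⟨hxW, -, -⟩ := memK x hx
      have h1 := hF (y + x) (W.add_mem hy hxW) r s p' hrs hp'r.symm hp's.symm c
      have h2 := hF (y - x) (W.sub_mem hy hxW) r s p' hrs hp'r.symm hp's.symm c
      have h3 := hF y hy r s p' hrs hp'r.symm hp's.symm c
      have h4 : (2 : K) * T c (ρ r x) (ρ s x) (ρ p' y) = 0 := by
        simp only [T, hρ, Pi.add_apply, Pi.sub_apply, hxp', add_zero, sub_zero] at h1 h2 h3 ⊢
        linear_combination h1 + h2 - 2 * h3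
      exact (mul_eq_zero.1 h4).resolve_left two_ne_zero
    have hTZ : ∀ x ∈ Kpq, ∀ w ∈ Z, ∀ c, T c (ρ r x) (ρ s x) w = 0 := by
      intro x hx w hw c
      obtain ⟨-, hxp, hxq⟩ := memK x hx
      rw [hZdef, Submodule.mem_sup] at hw
      obtain ⟨w₁, hw₁, w₂, hw₂, rfl⟩ := hw
      obtain ⟨y₁, hy₁, rfl⟩ := hw₁
      obtain ⟨y₂, hy₂, rfl⟩ := hw₂
      have a := hT1 x hx p hpr hps hxp y₁ hy₁ c
      have b := hT1 x hx q hqr hqs hxq y₂ hy₂ c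
      simp only [T, Pi.add_apply] at a b ⊢
      linear_combination a + b
    have hpairK : ∀ x ∈ Kpq, ∀ c₀ j : Fin 4, j ≠ c₀ →
        x (r, c₀) * x (s, j) + x (r, j) * x (s, c₀) = 0 :=
      fun x hx => pair_of_third Z (ρ r x) (ρ s x) hZ (hTZ x hx)
    -- non-zero single-row elements `xu` (row `r`) and `xv` (row `s`) of `Kpq`
    have hsingle : ∀ r' s' : Fin 4, r' ≠ s' → r' ≠ p → r' ≠ q → s' ≠ p → s' ≠ q →
        ∃ x ∈ Kpq, (∀ j, x (s', j) = 0) ∧ ∃ k, x (r', k) ≠ 0 := by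
      intro r' s' hr's' hr'p hr'q hs'p hs'q
      have h1 := finrank_eq_finrank_map_add_finrank_inf_ker Kpq (ρ s')
      have h2 : finrank K ↥(Kpq.map (ρ s')) ≤ 2 :=
        (Submodule.finrank_mono (Submodule.map_mono
          (inf_le_left.trans inf_le_left : Kpq ≤ W))).trans (hr s')
      have hA : (Kpq ⊓ LinearMap.ker (ρ s') : Submodule K _) ≠ ⊥ := fun h => by
        rw [h, finrank_bot] at h1; omega
      obtain ⟨x, hx, hx0⟩ := Submodule.exists_mem_ne_zero_of_ne_bot hA
      rw [Submodule.mem_inf, LinearMap.mem_ker] at hx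
      obtain ⟨-, hxp, hxq⟩ := memK x hx.1
      have hxs' : ∀ j, x (s', j) = 0 := fun j => congr_fun hx.2 j
      refine ⟨x, hx.1, hxs', ?_⟩
      by_contra hnone
      push Not at hnone
      apply hx0
      funext ⟨i, j⟩
      rcases hall p q r' s' (by assumption) (Ne.symm hr'p) (Ne.symm hs'p) (Ne.symm hr'q)
        (Ne.symm hs'q) hr's' i with rfl | rfl | rfl | rfl
      · exact hxp j
      · exact hxq j
      · exact hnone j
      · exact hxs' j
    obtain ⟨xu, hxuK, hxus, k₁, hk₁⟩ := hsingle r s hrs hpr.symm hqr.symm hps.symm hqs.symm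
    obtain ⟨xv, hxvK, hxvr, k₂, hk₂⟩ := hsingle s r hrs.symm hps.symm hqs.symm hpr.symm hqr.symm
    -- `dim row_s(Kpq) ≤ 1` and `dim row_r(Kpq) ≤ 1`
    have hs1 : finrank K ↥(Kpq.map (ρ s)) ≤ 1 := by
      refine finrank_le_one_of_pairings (Kpq.map (ρ s)) (ρ r xu) hk₁ ?_
      rintro _ ⟨x, hx, rfl⟩ j hj
      have a := hpairK (x + xu) (Kpq.add_mem hx hxuK) k₁ j hj
      have b := hpairK x hx k₁ j hj
      simp only [Pi.add_apply, hxus, add_zero, hρ] at a b ⊢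
      linear_combination a - b
    have hr1 : finrank K ↥(Kpq.map (ρ r)) ≤ 1 := by
      refine finrank_le_one_of_pairings (Kpq.map (ρ r)) (ρ s xv) hk₂ ?_
      rintro _ ⟨x, hx, rfl⟩ j hj
      have a := hpairK (x + xv) (Kpq.add_mem hx hxvK) k₂ j hj
      have b := hpairK x hx k₂ j hj
      simp only [Pi.add_apply, hxvr, add_zero, hρ] at a b ⊢
      linear_combination a - b
    -- hence `dim Kpq ≤ 2`
    have h1 := finrank_eq_finrank_map_add_finrank_inf_ker Kpq (ρ r)
    have h2 := finrank_eq_finrank_map_add_finrank_inf_ker (Kpq ⊓ LinearMap.ker (ρ r)) (ρ s)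
    have h3 : finrank K ↥((Kpq ⊓ LinearMap.ker (ρ r)).map (ρ s)) ≤ 1 :=
      (Submodule.finrank_mono (Submodule.map_mono inf_le_left)).trans hs1
    have h4 : (Kpq ⊓ LinearMap.ker (ρ r) ⊓ LinearMap.ker (ρ s) : Submodule K _) = ⊥ := by
      rw [eq_bot_iff]
      intro x hx
      simp only [Submodule.mem_inf, LinearMap.mem_ker] at hx
      obtain ⟨-, hxp, hxq⟩ := memK x hx.1.1
      rw [Submodule.mem_bot]
      funext ⟨i, j⟩
      rcases hall p q r s hpq hpr hps hqr hqs hrs i with rfl | rfl | rfl | rfl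
      · exact hxp j
      · exact hxq j
      · exact congr_fun hx.1.2 j
      · exact congr_fun hx.2 j
    rw [h4, finrank_bot] at h2
    omega
  -- (iv): `Σ dim Y_l ≥ 7`, so three rows have `dim Y = 2`
  have hsum : 7 ≤ finrank K ↥(W.map (ρ 0)) + finrank K ↥(W.map (ρ 1)) + finrank K ↥(W.map (ρ 2)) +
      finrank K ↥(W.map (ρ 3)) := by
    have h3 := finrank_eq_finrank_map_add_finrank_inf_ker W (ρ 3)
    have h2 := finrank_eq_finrank_map_add_finrank_inf_ker (W ⊓ LinearMap.ker (ρ 3)) (ρ 2)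
    have h1 := finrank_eq_finrank_map_add_finrank_inf_ker
      (W ⊓ LinearMap.ker (ρ 3) ⊓ LinearMap.ker (ρ 2)) (ρ 1)
    have h0 := finrank_eq_finrank_map_add_finrank_inf_ker
      (W ⊓ LinearMap.ker (ρ 3) ⊓ LinearMap.ker (ρ 2) ⊓ LinearMap.ker (ρ 1)) (ρ 0)
    have m2 : finrank K ↥((W ⊓ LinearMap.ker (ρ 3)).map (ρ 2)) ≤ finrank K ↥(W.map (ρ 2)) :=
      Submodule.finrank_mono (Submodule.map_mono inf_le_left)
    have m1 : finrank K ↥((W ⊓ LinearMap.ker (ρ 3) ⊓ LinearMap.ker (ρ 2)).map (ρ 1)) ≤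
        finrank K ↥(W.map (ρ 1)) :=
      Submodule.finrank_mono (Submodule.map_mono (inf_le_left.trans inf_le_left))
    have m0 : finrank K ↥((W ⊓ LinearMap.ker (ρ 3) ⊓ LinearMap.ker (ρ 2) ⊓ LinearMap.ker (ρ 1)).map
        (ρ 0)) ≤ finrank K ↥(W.map (ρ 0)) :=
      Submodule.finrank_mono (Submodule.map_mono
        ((inf_le_left.trans inf_le_left).trans inf_le_left))
    have hb : (W ⊓ LinearMap.ker (ρ 3) ⊓ LinearMap.ker (ρ 2) ⊓ LinearMap.ker (ρ 1) ⊓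
        LinearMap.ker (ρ 0) : Submodule K _) = ⊥ := by
      rw [eq_bot_iff]
      intro x hx
      simp only [Submodule.mem_inf, LinearMap.mem_ker] at hx
      rw [Submodule.mem_bot]
      funext ⟨i, j⟩
      rcases hcases i with rfl | rfl | rfl | rfl
      · exact congr_fun hx.2 j
      · exact congr_fun hx.1.2 j
      · exact congr_fun hx.1.1.2 j
      · exact congr_fun hx.1.1.1.2 j
    rw [hb, finrank_bot] at h0
    omega
  have r0 := hr 0; have r1 := hr 1; have r2 := hr 2; have r3 := hr 3
  change finrank K ↥(W.map (ρ 0)) ≤ 2 at r0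
  change finrank K ↥(W.map (ρ 1)) ≤ 2 at r1
  change finrank K ↥(W.map (ρ 2)) ≤ 2 at r2
  change finrank K ↥(W.map (ρ 3)) ≤ 2 at r3
  -- a row `a` with `dim Y_a = 2` such that every other row `l ≠ a` with `dim Y_l = 2` too, except
  -- possibly one; we just need one `a` with `dim Y_a = 2` (all `Y_l` then lie in `Y_a`)
  obtain ⟨a, ha⟩ : ∃ a : Fin 4, finrank K ↥(W.map (ρ a)) = 2 := by
    by_cases h0 : finrank K ↥(W.map (ρ 0)) = 2
    · exact ⟨0, h0⟩
    · exact ⟨1, by omega⟩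
  have hsub : ∀ l : Fin 4, W.map (ρ l) ≤ W.map (ρ a) := by
    intro l
    by_cases hla : l = a
    · rw [hla]
    · obtain ⟨r, s, har, has, hlr, hls, hrs⟩ : ∃ r s : Fin 4, a ≠ r ∧ a ≠ s ∧ l ≠ r ∧ l ≠ s ∧ r ≠ s := by
        have key : ∀ a l : Fin 4, l ≠ a → ∃ r s : Fin 4, a ≠ r ∧ a ≠ s ∧ l ≠ r ∧ l ≠ s ∧ r ≠ s := by
          decide
        exact key a l hla
      have h2 := hsup2 a l r s (Ne.symm hla) har has hlr hls hrs
      have heq : W.map (ρ a) ⊔ W.map (ρ l) = W.map (ρ a) :=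
        (Submodule.eq_of_le_of_finrank_le le_sup_left (by rw [ha]; exact h2)).symm
      exact le_sup_right.trans heq.le
  -- (v): two coordinates separating the plane `P = Y_a`
  set P := W.map (ρ a) with hPdef
  have hP0 : P ≠ ⊥ := fun h => by rw [h, finrank_bot] at ha; exact absurd ha (by decide)
  obtain ⟨w, hwP, hw0⟩ := Submodule.exists_mem_ne_zero_of_ne_bot hP0
  obtain ⟨k, hk⟩ : ∃ k, w k ≠ 0 := Function.ne_iff.1 hw0
  set P₁ : Submodule K (Fin 4 → K) := P ⊓ LinearMap.ker (LinearMap.proj k) with hP₁def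
  have hP₁ : finrank K P₁ = 1 := by
    have h := finrank_eq_finrank_map_add_finrank_inf_ker P (LinearMap.proj k : (Fin 4 → K) →ₗ[K] K)
    have hle : finrank K ↥(P.map (LinearMap.proj k : (Fin 4 → K) →ₗ[K] K)) ≤ 1 :=
      (Submodule.finrank_le _).trans (finrank_self K).le
    have hne : P.map (LinearMap.proj k : (Fin 4 → K) →ₗ[K] K) ≠ ⊥ := by
      intro hb
      have : (LinearMap.proj k : (Fin 4 → K) →ₗ[K] K) w ∈ P.map (LinearMap.proj k) :=
        Submodule.mem_map_of_mem hwP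
      rw [hb, Submodule.mem_bot] at this
      exact hk this
    have hge : 1 ≤ finrank K ↥(P.map (LinearMap.proj k : (Fin 4 → K) →ₗ[K] K)) := by
      by_contra hlt
      push Not at hlt
      exact hne (Submodule.finrank_eq_zero.1 (by omega))
    rw [← hP₁def] at h
    omega
  have hP₁0 : P₁ ≠ ⊥ := fun h => by rw [h, finrank_bot] at hP₁; exact absurd hP₁ (by decide)
  obtain ⟨w', hw'P, hw'0⟩ := Submodule.exists_mem_ne_zero_of_ne_bot hP₁0
  obtain ⟨k', hk'⟩ : ∃ k', w' k' ≠ 0 := Function.ne_iff.1 hw'0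
  have hw'k : w' k = 0 := by
    rw [hP₁def, Submodule.mem_inf, LinearMap.mem_ker] at hw'P
    exact hw'P.2
  have hkk' : k ≠ k' := fun h => hk' (h ▸ hw'k)
  have hspan : P₁ = K ∙ w' := by
    refine (Submodule.eq_of_le_of_finrank_eq ?_ ?_).symm
    · exact (Submodule.span_singleton_le_iff_mem _ _).2 hw'P
    · rw [finrank_span_singleton hw'0, hP₁]
  have hsep : ∀ v ∈ P, v k = 0 → v k' = 0 → v = 0 := by
    intro v hv hvk hvk'
    have hv₁ : v ∈ P₁ := by
      rw [hP₁def, Submodule.mem_inf, LinearMap.mem_ker]; exact ⟨hv, hvk⟩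
    rw [hspan, Submodule.mem_span_singleton] at hv₁
    obtain ⟨μ, rfl⟩ := hv₁
    have : μ * w' k' = 0 := by simpa using hvk'
    rcases mul_eq_zero.1 this with h | h
    · rw [h, zero_smul]
    · exact absurd h hk'
  -- the columns `k, k'` detect `W`
  refine hnc ⟨k, k', hkk', fun x hx hxk hxk' => ?_⟩
  funext ⟨i, j⟩
  have hrow : ρ i x = 0 :=
    hsep (ρ i x) (hsub i ⟨x, hx, rfl⟩) (hxk i) (hxk' i)
  exact congr_fun hrow j

end Summit.ValiantsHypothesis.ValiantsHypothesis.Theorems.SymPencilBoxFourSevenSmall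

end
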